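import Summits.HodgeConjecture.HodgeConjecture.Theorems.Ring2AbelianAllWeilHyperbolicDescent
import Summits.HodgeConjecture.HodgeConjecture.Theorems.Ring2AbelianAllEvenTimesEven
import Literature.AlgebraicGeometry.Motives.PrymVariety
import Literature.AlgebraicGeometry.Motives.SegreHyperplaneClass
import HarnessLib

/-!
# Ring 2 · AbelianAll (ab-weil-1, gen 137) — the symmetrised descent inside `A × A`: the geometric
  input that discharges the print obligation `HyperplanePullbackAlongIsogeny` on the split slices and δ-cells

research route, not a corollary; conditional on HC_CM plus one named minimal statement.
Cell line: research route conditional on HC_CM; not a corollary; Q11.4-sentence-2 already refuted in dim ≥ 3.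
`HC_CM` (`Theses.RankFourFaces.CMAbelianHodge`) does not occur in this file. No case of the Hodge
conjecture is claimed: every statement below is an IMPLICATION or EQUIVALENCE between open statements,
now UNCONDITIONAL where gens 5–7 carried the typed print obligation `HyperplanePullbackAlongIsogeny`
(`H_amp`: along an isogeny the pull-back of a hyperplane class is a non-zero rational multiple of a
hyperplane class — first Chern classes and ampleness, absent from the tree).

THE MECHANISM (new). The uses of `H_amp` never needed the pulled-back class `f^*(e^*a)` itself to be a
hyperplane class of the descended variety `B`: the Weil-type predicates (`IsHyperbolicWeilType`,
`HasWeilDiscriminantNondeg`) are evaluated on the `K`-SYMMETRISED class `d·y + ψ^*y` and are invariant under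
`y ↦ c·y`, `c ∈ ℚ^×`. So it suffices to produce ONE projective embedding `e'` of `B` whose symmetrised
hyperplane class is a rational multiple of the symmetrised class of `y = f^*(e^*a)`. We get it by choosing
the descent variety INSIDE `A × A`:

* §1 `SubDescent` — for `φ' ∈ End A` with `φ'² = -m²d` (`m ≥ 1`) let `B := (Ker Φ)⁰_red ⊂ A × A`,
  `Φ(x, y) = φ'(x) - m·y` (the tree's `AbelianVariety.kerComponent`, a closed abelian subvariety), with
  `ψ(x, y) = (y, -d·x)` (`ψ² = -d`; `B` is `ψ`-stable because `m·(φ'(y) + md·x) = φ'²(x) + m²d·x = 0` on `B`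
  and `Hom(B, A)` is torsion free), `f = pr₁|_B`, `p = (m, φ') : A → B`: then `p ≫ f = [m]`, `f ≫ p = [m]`,
  `f ≫ φ' = mψ ≫ f`, `p ≫ mψ = φ' ≫ p`, `dim B = dim A` (`f^*`, `p^*` injective on `H¹`), `p`, `f` isogenies —
  the descent datum of gen 5 (`exists_isogeny_sq_descent'`) realised with `pr₂|_B = ψ ≫ f`
  (`exists_subDescent`);
* §2 `exists_symmetrisedDescent` — restricting to `B` the Segre embedding of `s_{d-1}(e) × e`
  (`Motives/SegreHyperplaneClass`: Segre-additive rational generators `g_N`, `s_{d-1}^* g = d·g`) gives a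
  projective embedding `e'` of `B` with `e'^* g = d·f^*h + (ψ ≫ f)^*h = d·Y + ψ^*Y` EXACTLY, `Y = f^*(e^*g_N)`;
  `e^*a = q·e^*g_N`, `q ∈ ℚ^×` (`H²(ℙᴺ(ℂ); ℂ)` is a line), and `Sym ∘ Sym = 2d·Sym`
  (`symmetrised_symmetrised`), so `d·e'^*g + ψ^*e'^*g = (2d/q)·(d·y + ψ^*y)`, `y = f^*(e^*a)`;
* §3 = the sequel `Ring2AbelianAllWeilSymmetrisedRungs` — the transports of gens 5–7 with `H_amp` ERASED:
  the split slices (`weilAlgebraicSplitHyperplane_sq_mul'`), the named split rungs, and every δ-cell, split or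
  not (`weilClassesComponent_sq_mul'`); this file is the geometric input `exists_symmetrisedDescent` alone.

NOT discharged: the NON-SPLIT upward transport in the formulation `weilAlgebraicNonsplitHyperplane_sq_mul`
(gen 5), which quantifies over ALL hyperplane classes of the variety and would need a hyperplane class of `A`
obtained through `p : A → B` (which has a kernel); it keeps `H_amp`. `H_amp` itself is neither proved nor
refuted here.

## References
* D. Mumford, *Abelian Varieties* (1970), §19 Thm. 3 (Hom torsion free), p. 173 (`(Ker)⁰_red`). [MumfordAV1970]
* R. Hartshorne, *Algebraic Geometry* (1977), II Ex. 5.11–5.12 (Segre, `𝒪(1,1)`). [Hartshorne1977]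
* B. van Geemen, LNM 1594 (1994), Lemma 5.2 (2)–(3), 5.4. [vanGeemen1994HodgeAV]
* B. Moonen, Yu. Zarhin, Crelle 496 (1998), §1. [MoonenZarhin1998WeilClasses]
* E. Markman, arXiv:2509.23403, §11.5 Step 2 (weighted Segre classes). [Markman2025SurveySecant]
* K. Koike, Canad. Math. Bull. 47 (2004), Cor. 2.1, Rem. 2.1. [Koike2004WeilHodge]
* C. Schoen, Compositio Math. 114 (1998), §10 and Theorem p. 329. [Schoen1998HodgeWeilAddendum]
* A. Hatcher, *Algebraic Topology* (2002), Thm. 3.26. [HatcherAT2002]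
-/

noncomputable section

set_option linter.dupNamespace false

open CategoryTheory AlgebraicGeometry MonoidalCategory
open Literature.AlgebraicGeometry Literature.AlgebraicGeometry.Motives
open Literature.AlgebraicGeometry.HodgeTheory
open Literature.AlgebraicTopology.SingularHomology
open Literature.AlgebraicGeometry.Motives.SegreHyperplaneClass
open Summit.HodgeConjecture.HodgeConjecture.Cruxes.HodgeAbelianVarieties.EStepSecantInduction
open Summit.HodgeConjecture.HodgeConjecture.WeilTypeLadder

namespace Summit.HodgeConjecture.HodgeConjecture.Ring2.AbelianAll

/-! ### §1 The descent variety inside `A × A` -/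

namespace SubDescent

variable {A : AbelianVariety ℂ}

/-- `Φ(x, y) = φ'(x) - m·y : A × A → A`. [cite: MumfordAV1970, §19 p. 173] -/
def descentMap (φ' : A ⟶ A) (m : ℕ) : A.prod A ⟶ A :=
  AbelianVariety.fst A A ≫ φ' - (m : ℤ) • AbelianVariety.snd A A

/-- `B = (Ker Φ)⁰_red = {(x, y) : φ'(x) = m·y}⁰`, a closed abelian subvariety of `A × A`.
[cite: MumfordAV1970, §19 p. 173] -/
def B (φ' : A ⟶ A) (m : ℕ) : AbelianVariety ℂ := AbelianVariety.kerComponent (descentMap φ' m)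

/-- The inclusion `ι : B ↪ A × A` (a homomorphism, a closed immersion, a monomorphism).
[cite: MumfordAV1970, §19 p. 173] -/
def ι (φ' : A ⟶ A) (m : ℕ) : B φ' m ⟶ A.prod A := AbelianVariety.kerComponentι (descentMap φ' m)

/-- `f = pr₁ ∘ ι : B → A`. [folklore] -/
def f (φ' : A ⟶ A) (m : ℕ) : B φ' m ⟶ A := ι φ' m ≫ AbelianVariety.fst A A

/-- `f₂ = pr₂ ∘ ι : B → A`. [folklore] -/
def f₂ (φ' : A ⟶ A) (m : ℕ) : B φ' m ⟶ A := ι φ' m ≫ AbelianVariety.snd A A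

/-- `U(x, y) = (y, -d·x)` on `A × A`. [folklore] -/
def U (A : AbelianVariety ℂ) (d : ℕ) : A.prod A ⟶ A.prod A :=
  AbelianVariety.prodLift (AbelianVariety.snd A A) (-((d : ℤ) • AbelianVariety.fst A A))

/-- `ι` is a monomorphism. [cite: MumfordAV1970, §19 p. 173] -/
instance (φ' : A ⟶ A) (m : ℕ) : Mono (ι φ' m) := AbelianVariety.mono_kerComponentι _

/-- `ι` is a closed immersion of schemes. [cite: MumfordAV1970, §19 p. 173] -/
instance (φ' : A ⟶ A) (m : ℕ) : IsClosedImmersion (AbelianVariety.Hom.toSchemeHom (ι φ' m)) :=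
  AbelianVariety.isClosedImmersion_toSchemeHom_kerComponentι _

/-- On `B`: `φ' ∘ pr₁ = m · pr₂`. [folklore] -/
theorem f_comp_φ (φ' : A ⟶ A) (m : ℕ) : f φ' m ≫ φ' = (m : ℤ) • f₂ φ' m := by
  have h := AbelianVariety.kerComponentι_comp (descentMap φ' m)
  change ι φ' m ≫ (AbelianVariety.fst A A ≫ φ' - (m : ℤ) • AbelianVariety.snd A A) = 0 at h
  rw [Preadditive.comp_sub, Preadditive.comp_zsmul, sub_eq_zero, ← Category.assoc] at h
  exact h

/-- `U ≫ pr₁ = pr₂`. [folklore] -/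
@[reassoc]
theorem U_fst (A : AbelianVariety ℂ) (d : ℕ) : U A d ≫ AbelianVariety.fst A A = AbelianVariety.snd A A :=
  AbelianVariety.prodLift_fst _ _

/-- `U ≫ pr₂ = -d·pr₁`. [folklore] -/
@[reassoc]
theorem U_snd (A : AbelianVariety ℂ) (d : ℕ) :
    U A d ≫ AbelianVariety.snd A A = -((d : ℤ) • AbelianVariety.fst A A) :=
  AbelianVariety.prodLift_snd _ _

/-- `U ≫ U = -d`. [folklore] -/
theorem U_sq (A : AbelianVariety ℂ) (d : ℕ) : U A d ≫ U A d = -((d : ℤ) • 𝟙 (A.prod A)) := by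
  refine AbelianVariety.prod_hom_ext ?_ ?_
  · rw [Category.assoc, U_fst, U_snd, Preadditive.neg_comp, Preadditive.zsmul_comp, Category.id_comp]
  · rw [Category.assoc, U_snd, Preadditive.comp_neg, Preadditive.comp_zsmul, U_fst, Preadditive.neg_comp,
      Preadditive.zsmul_comp, Category.id_comp]

/-- `ι ≫ U` has components `(f₂, -d·f)`. [folklore] -/
theorem ι_U_fst (φ' : A ⟶ A) (m d : ℕ) : (ι φ' m ≫ U A d) ≫ AbelianVariety.fst A A = f₂ φ' m := by
  rw [Category.assoc, U_fst]; rfl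

/-- `(ι ≫ U) ≫ pr₂ = -d·f`. [folklore] -/
theorem ι_U_snd (φ' : A ⟶ A) (m d : ℕ) :
    (ι φ' m ≫ U A d) ≫ AbelianVariety.snd A A = -((d : ℤ) • f φ' m) := by
  rw [Category.assoc, U_snd, Preadditive.comp_neg, Preadditive.comp_zsmul]; rfl

/-- `B` is `U`-stable: `ι ≫ U ≫ Φ = 0` (`m` times it is `pr₁|_B ≫ (φ'² + m²d) = 0`, and `Hom` is torsion
free). [cite: MumfordAV1970, §19 Thm. 3] -/
theorem ι_U_descentMap {φ' : A ⟶ A} {m d : ℕ} (hm : m ≠ 0) (hφ' : φ' ≫ φ' = -((m ^ 2 * d) • 𝟙 A)) :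
    (ι φ' m ≫ U A d) ≫ descentMap φ' m = 0 := by
  have h1 : (ι φ' m ≫ U A d) ≫ descentMap φ' m = f₂ φ' m ≫ φ' + ((m : ℤ) * d) • f φ' m := by
    change (ι φ' m ≫ U A d) ≫ (AbelianVariety.fst A A ≫ φ' - (m : ℤ) • AbelianVariety.snd A A) = _
    rw [Preadditive.comp_sub, Preadditive.comp_zsmul, ← Category.assoc, ι_U_fst, ι_U_snd, smul_neg,
      sub_neg_eq_add, smul_smul]
  have h2 : (m : ℤ) • (f₂ φ' m ≫ φ') = -(((m ^ 2 * d : ℕ) : ℤ) • f φ' m) := by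
    rw [← Preadditive.zsmul_comp, ← f_comp_φ, Category.assoc, hφ', Preadditive.comp_neg,
      Preadditive.comp_nsmul, Category.comp_id, natCast_zsmul]
  refine zsmul_left_cancel hm ?_
  rw [smul_zero, h1, smul_add, h2, smul_smul, ← neg_smul, ← add_smul]
  have hc : (-((m ^ 2 * d : ℕ) : ℤ) + (m : ℤ) * ((m : ℤ) * d)) = 0 := by push_cast; ring
  rw [hc, zero_smul]

/-- `ψ : B → B`, `ψ(x, y) = (y, -d·x)` (the lift of `ι ≫ U`). [folklore] -/
def ψ {φ' : A ⟶ A} {m d : ℕ} (hm : m ≠ 0) (hφ' : φ' ≫ φ' = -((m ^ 2 * d) • 𝟙 A)) : B φ' m ⟶ B φ' m :=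
  AbelianVariety.kerComponentLift (ι φ' m ≫ U A d) (ι_U_descentMap hm hφ')

section

variable {φ' : A ⟶ A} {m d : ℕ} (hm : m ≠ 0) (hφ' : φ' ≫ φ' = -((m ^ 2 * d) • 𝟙 A))

/-- `ψ ≫ ι = ι ≫ U` (the defining property of the lift). [folklore] -/
@[reassoc]
theorem ψ_ι : ψ hm hφ' ≫ ι φ' m = ι φ' m ≫ U A d := AbelianVariety.kerComponentLift_ι _ _

/-- `ψ² = -d`. [folklore] -/
theorem ψ_sq : ψ hm hφ' ≫ ψ hm hφ' = -(d • 𝟙 (B φ' m)) := by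
  rw [← cancel_mono (ι φ' m), Category.assoc, ψ_ι, ψ_ι_assoc, U_sq, Preadditive.comp_neg,
    Preadditive.comp_zsmul, Category.comp_id, Preadditive.neg_comp, Preadditive.nsmul_comp, Category.id_comp,
    natCast_zsmul]

/-- `pr₂|_B = ψ ≫ pr₁|_B`. [folklore] -/
theorem ψ_f : ψ hm hφ' ≫ f φ' m = f₂ φ' m := by
  change ψ hm hφ' ≫ ι φ' m ≫ AbelianVariety.fst A A = _
  rw [ψ_ι_assoc, U_fst]
  rfl

/-- `f` intertwines `φ'` and `mψ`: `f ≫ φ' = (mψ) ≫ f`. [folklore] -/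
theorem f_comm : f φ' m ≫ φ' = ((m : ℤ) • ψ hm hφ') ≫ f φ' m := by
  rw [Preadditive.zsmul_comp, ψ_f, f_comp_φ]

end

/-- `p = (m, φ') : A → B`. [folklore] -/
def p (φ' : A ⟶ A) (m : ℕ) : A ⟶ B φ' m :=
  AbelianVariety.kerComponentLift (AbelianVariety.prodLift ((m : ℤ) • 𝟙 A) φ') (by
    change AbelianVariety.prodLift ((m : ℤ) • 𝟙 A) φ' ≫
      (AbelianVariety.fst A A ≫ φ' - (m : ℤ) • AbelianVariety.snd A A) = 0
    rw [Preadditive.comp_sub, Preadditive.comp_zsmul, ← Category.assoc, AbelianVariety.prodLift_fst,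
      AbelianVariety.prodLift_snd, Preadditive.zsmul_comp, Category.id_comp, sub_self])

/-- `p ≫ ι = (m, φ')`. [folklore] -/
@[reassoc]
theorem p_ι (φ' : A ⟶ A) (m : ℕ) : p φ' m ≫ ι φ' m = AbelianVariety.prodLift ((m : ℤ) • 𝟙 A) φ' :=
  AbelianVariety.kerComponentLift_ι _ _

/-- `p ≫ f = [m]_A`. [folklore] -/
theorem p_f (φ' : A ⟶ A) (m : ℕ) : p φ' m ≫ f φ' m = (m : ℤ) • 𝟙 A := by
  change p φ' m ≫ ι φ' m ≫ AbelianVariety.fst A A = _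
  rw [p_ι_assoc, AbelianVariety.prodLift_fst]

/-- `f ≫ p = [m]_B`. [folklore] -/
theorem f_p (φ' : A ⟶ A) (m : ℕ) : f φ' m ≫ p φ' m = (m : ℤ) • 𝟙 (B φ' m) := by
  rw [← cancel_mono (ι φ' m), Category.assoc, p_ι, Preadditive.zsmul_comp, Category.id_comp]
  refine AbelianVariety.prod_hom_ext ?_ ?_
  · rw [Category.assoc, AbelianVariety.prodLift_fst, Preadditive.comp_zsmul, Category.comp_id,
      Preadditive.zsmul_comp]
    rfl
  · rw [Category.assoc, AbelianVariety.prodLift_snd, Preadditive.zsmul_comp, f_comp_φ]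
    rfl

/-- `p` intertwines `mψ` and `φ'`: `p ≫ mψ = φ' ≫ p`. [folklore] -/
theorem p_comm {φ' : A ⟶ A} {m d : ℕ} (hm : m ≠ 0) (hφ' : φ' ≫ φ' = -((m ^ 2 * d) • 𝟙 A)) :
    p φ' m ≫ ((m : ℤ) • ψ hm hφ') = φ' ≫ p φ' m := by
  rw [← cancel_mono (ι φ' m), Category.assoc, Category.assoc, p_ι, Preadditive.zsmul_comp, ψ_ι,
    Preadditive.comp_zsmul, p_ι_assoc]
  refine AbelianVariety.prod_hom_ext ?_ ?_
  · rw [Preadditive.zsmul_comp, Category.assoc, U_fst, AbelianVariety.prodLift_snd, Category.assoc,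
      AbelianVariety.prodLift_fst, Preadditive.comp_zsmul, Category.comp_id]
  · rw [Preadditive.zsmul_comp, Category.assoc, U_snd, Preadditive.comp_neg, Preadditive.comp_zsmul,
      AbelianVariety.prodLift_fst, Category.assoc, AbelianVariety.prodLift_snd, hφ', smul_neg, smul_smul,
      smul_smul, ← natCast_zsmul]
    push_cast
    ring_nf

/-- `dim B = dim A`: `f^*` and `p^*` are injective on `H¹` (`p ≫ f = [m]`, `f ≫ p = [m]`) and
`b₁ = 2·dim`. [cite: MumfordAV1970, §1 (3) and §19 Remark p. 169] -/
theorem dim_eq (φ' : A ⟶ A) {m : ℕ} (hm : m ≠ 0) : (B φ' m).dim = A.dim := by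
  haveI := finite_complexBetti_abelianVariety A 1
  haveI := finite_complexBetti_abelianVariety (B φ' m) 1
  have hpf : p φ' m ≫ f φ' m = m • 𝟙 A := by rw [p_f, natCast_zsmul]
  have hfp : f φ' m ≫ p φ' m = m • 𝟙 (B φ' m) := by rw [f_p, natCast_zsmul]
  have h1 := LinearMap.finrank_le_finrank_of_injective
    (f := (complexBetti.map (f φ' m).hom.hom.hom 1).hom) (complexBetti_map_injective_of_comp_eq_nsmul_id hm hpf 1)
  have h2 := LinearMap.finrank_le_finrank_of_injective
    (f := (complexBetti.map (p φ' m).hom.hom.hom 1).hom) (complexBetti_map_injective_of_comp_eq_nsmul_id hm hfp 1)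
  rw [AbelianVariety.finrank_complexBetti_one, AbelianVariety.finrank_complexBetti_one] at h1 h2
  omega

/-- `p` is an isogeny. [cite: MumfordAV1970, §19 Remark p. 169] -/
theorem isIsogeny_p (φ' : A ⟶ A) {m : ℕ} (hm : m ≠ 0) : AbelianVariety.IsIsogeny (p φ' m) :=
  AbelianVariety.isIsogeny_of_comp_eq_nsmul_id (m := m) (Nat.cast_ne_zero.mpr hm)
    (by rw [p_f, natCast_zsmul]) (dim_eq φ' hm).symm

/-- `f` is an isogeny. [cite: MumfordAV1970, §19 Remark p. 169] -/
theorem isIsogeny_f (φ' : A ⟶ A) {m : ℕ} (hm : m ≠ 0) : AbelianVariety.IsIsogeny (f φ' m) :=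
  AbelianVariety.isIsogeny_of_comp_eq_nsmul_id (m := m) (Nat.cast_ne_zero.mpr hm)
    (by rw [f_p, natCast_zsmul]) (dim_eq φ' hm)

end SubDescent

/-- **The descent datum realised inside `A × A`.** If `φ'² = -m²d` on `A` (`m ≥ 1`) there are an abelian
variety `B`, isogenies `p : A → B`, `f : B → A` with `p ≫ f = [m]_A`, `f ≫ p = [m]_B`, `ψ ∈ End B` with
`ψ² = -d`, `f ≫ φ' = mψ ≫ f`, `p ≫ mψ = φ' ≫ p` — as in gen 5's `exists_isogeny_sq_descent'` — AND a
homomorphism `ι : B → A × A` which is a closed immersion with `ι ≫ pr₁ = f`, `ι ≫ pr₂ = ψ ≫ f`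
(`B = {(x, y) : φ'x = my}⁰`, `ψ(x, y) = (y, -dx)`, `p = (m, φ')`). [cite: MumfordAV1970, §19 Thm. 3 and p. 173] -/
theorem exists_subDescent {A : AbelianVariety ℂ} {m d : ℕ} (hm : m ≠ 0) {φ' : A ⟶ A}
    (hφ' : φ' ≫ φ' = -((m ^ 2 * d) • 𝟙 A)) :
    ∃ (B : AbelianVariety ℂ) (p : A ⟶ B) (f : B ⟶ A) (ψ : B ⟶ B) (ι : B ⟶ A.prod A),
      AbelianVariety.IsIsogeny p ∧ AbelianVariety.IsIsogeny f ∧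
        p ≫ f = (m : ℤ) • 𝟙 A ∧ f ≫ p = (m : ℤ) • 𝟙 B ∧ ψ ≫ ψ = -(d • 𝟙 B) ∧
          f ≫ φ' = ((m : ℤ) • ψ) ≫ f ∧ p ≫ ((m : ℤ) • ψ) = φ' ≫ p ∧
            IsClosedImmersion (AbelianVariety.Hom.toSchemeHom ι) ∧
              ι ≫ AbelianVariety.fst A A = f ∧ ι ≫ AbelianVariety.snd A A = ψ ≫ f :=
  ⟨SubDescent.B φ' m, SubDescent.p φ' m, SubDescent.f φ' m, SubDescent.ψ hm hφ', SubDescent.ι φ' m,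
    SubDescent.isIsogeny_p φ' hm, SubDescent.isIsogeny_f φ' hm, SubDescent.p_f φ' m,
    SubDescent.f_p φ' m, SubDescent.ψ_sq hm hφ', SubDescent.f_comm hm hφ', SubDescent.p_comm hm hφ',
    inferInstance, rfl, (SubDescent.ψ_f hm hφ').symm⟩


/-! ### §2 The symmetrised hyperplane class of the descent variety -/

/-- In `H²(ℙᴺ(ℂ); ℂ) = ℂ` a non-zero RATIONAL class is a non-zero rational multiple of any non-zero rational
class. [cite: VoisinHodgeI2002, §7.1.1 and §11.3.1] -/
theorem exists_eq_ratCast_smul_of_projectiveSpace {N : ℕ} {g a : complexBetti (projectiveSpace N ℂ) 2}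
    (hg : IsRationalClass g) (hg0 : g ≠ 0) (ha : IsRationalClass a) (ha0 : a ≠ 0) :
    ∃ q : ℚ, q ≠ 0 ∧ a = (q : ℂ) • g := by
  have hN := one_le_of_ne_zero_projectiveSpace_two ha0
  have h1 : Module.finrank ℂ (complexBetti (projectiveSpace N ℂ) 2) = 1 :=
    finrank_complexBetti_projectiveSpace_two_mul_eq_one N (p := 1) hN
  obtain ⟨t, ht⟩ := (finrank_eq_one_iff_of_nonzero' g hg0).1 h1 a
  obtain ⟨q, hq⟩ := SegreHyperplaneClass.exists_ratCast_eq_of_isRationalClass_smul hg hg0 (z := t)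
    (by rw [ht]; exact ha)
  refine ⟨q, ?_, ?_⟩
  · rintro rfl
    apply ha0
    rw [← ht, ← hq, Rat.cast_zero, zero_smul]
  · rw [hq, ht]

/-- `Sym ∘ Sym = 2d · Sym` for the `K`-symmetrisation `Sym(y) = d·y + ψ^*y`, `ψ² = -d` (`ψ^*ψ^* = d²` on
`H²`). [cite: vanGeemen1994HodgeAV, 5.2] -/
theorem symmetrised_symmetrised {B : AbelianVariety ℂ} {ψ : B ⟶ B} {d : ℕ} (hψ : ψ ≫ ψ = -(d • 𝟙 B))
    (y : complexBetti B.X 2) :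
    (d : ℂ) • ((d : ℂ) • y + complexBetti.map ψ.hom.hom.hom 2 y) +
        complexBetti.map ψ.hom.hom.hom 2 ((d : ℂ) • y + complexBetti.map ψ.hom.hom.hom 2 y) =
      (2 * d : ℂ) • ((d : ℂ) • y + complexBetti.map ψ.hom.hom.hom 2 y) := by
  rw [map_add, map_smul, map_map_hom_apply ψ ψ, hψ, complexBetti_map_neg_nsmul_id_two]
  module

/-- **The symmetrised descent** (`m, d ≥ 1`, `φ'² = -m²d` on `A`, `e : A ↪ ℙᴺ`, `a ∈ H²(ℙᴺ; ℚ)`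
non-zero). There are `B`, isogenies `p : A → B`, `f : B → A` (`p ≫ f = [m]`, `f ≫ p = [m]`), `ψ ∈ End B`
with `ψ² = -d`, `f ≫ φ' = mψ ≫ f`, `p ≫ mψ = φ' ≫ p`, AND a projective embedding `e' : B ↪ ℙᴹ` with a
non-zero rational `a' ∈ H²(ℙᴹ)` whose `K`-SYMMETRISED class `d·e'^*a' + ψ^*e'^*a'` is a non-zero RATIONAL
multiple of the symmetrised class `d·y + ψ^*y` of `y = f^*e^*a`. Construction: `B = {(x, y) : φ'x = my}⁰ ⊂
A × A`, `ψ(x, y) = (y, -dx)`; `e'` = the restriction to `B` of `Segre ∘ ((segrePow_{d-1} ∘ e) ⊗ e)` on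
`A × A`, whose hyperplane class on `B` is `d·f^*h + (ψ ≫ f)^*h`, `h = e^*(gen)`; `a = q·gen` (`q ∈ ℚˣ`,
`H²(ℙᴺ) = ℂ`), and `Sym ∘ Sym = 2d·Sym`. This DISCHARGES the print obligation
`HyperplanePullbackAlongIsogeny` in every use where only the symmetrised class matters.
[cite: MumfordAV1970, §19 Thm. 3 and p. 173] [cite: Hartshorne1977, II Ex. 5.11–5.12]
[cite: vanGeemen1994HodgeAV, 5.2] -/
theorem exists_symmetrisedDescent {A : AbelianVariety ℂ} {m d : ℕ} (hm : m ≠ 0) (hd : 0 < d) {φ' : A ⟶ A}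
    (hφ' : φ' ≫ φ' = -((m ^ 2 * d) • 𝟙 A)) (e : ProjectiveEmbedding A.X)
    (a : complexBetti (projectiveSpace e.n ℂ) 2) (ha : IsRationalClass a) (ha0 : a ≠ 0) :
    ∃ (B : AbelianVariety ℂ) (p : A ⟶ B) (f : B ⟶ A) (ψ : B ⟶ B),
      AbelianVariety.IsIsogeny p ∧ AbelianVariety.IsIsogeny f ∧
        p ≫ f = (m : ℤ) • 𝟙 A ∧ f ≫ p = (m : ℤ) • 𝟙 B ∧ ψ ≫ ψ = -(d • 𝟙 B) ∧
          f ≫ φ' = ((m : ℤ) • ψ) ≫ f ∧ p ≫ ((m : ℤ) • ψ) = φ' ≫ p ∧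
            ∃ (e' : ProjectiveEmbedding B.X) (a' : complexBetti (projectiveSpace e'.n ℂ) 2) (c : ℚ),
              IsRationalClass a' ∧ a' ≠ 0 ∧ c ≠ 0 ∧
                (d : ℂ) • complexBetti.map e'.ι 2 a' +
                    complexBetti.map ψ.hom.hom.hom 2 (complexBetti.map e'.ι 2 a') =
                  (c : ℂ) • ((d : ℂ) • complexBetti.map f.hom.hom.hom 2 (complexBetti.map e.ι 2 a) +
                    complexBetti.map ψ.hom.hom.hom 2
                      (complexBetti.map f.hom.hom.hom 2 (complexBetti.map e.ι 2 a))) := by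
  obtain ⟨B, p, f, ψ, ι, hp, hf, hpf, hfp, hψ, hfφ, hpψ, hι, hι₁, hι₂⟩ := exists_subDescent hm hφ'
  obtain ⟨d', rfl⟩ : ∃ d', d = d' + 1 := ⟨d - 1, by omega⟩
  obtain ⟨g, hgr, hgnz, hgσ⟩ := exists_segreHyperplaneClasses
  have hN1 : 1 ≤ e.n := one_le_of_ne_zero_projectiveSpace_two ha0
  obtain ⟨q, hq0, hq⟩ := exists_eq_ratCast_smul_of_projectiveSpace (hgr e.n) (hgnz e.n hN1) ha ha0
  -- `ι` on schemes, with its source and target spelled `B.X ⟶ A.X ⊗ A.X`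
  obtain ⟨ιι, hιι⟩ : ∃ ιι : B.X ⟶ A.X ⊗ A.X, ιι = ι.hom.hom.hom := ⟨_, rfl⟩
  haveI hιιci : IsClosedImmersion ιι.left := by rw [hιι]; exact hι
  have hf₁ : ιι ≫ CartesianMonoidalCategory.fst A.X A.X = f.hom.hom.hom := by
    rw [hιι, ← hι₁]; rfl
  have hf₂ : ιι ≫ CartesianMonoidalCategory.snd A.X A.X = (ψ ≫ f).hom.hom.hom := by
    rw [hιι, ← hι₂]; rfl
  -- the embedding `e' : B ↪ A × A ↪ ℙ^{n_{d'}} × ℙᴺ ↪ ℙ^{n_{d'} N + n_{d'} + N}`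
  haveI := isClosedImmersion_segrePow_left e.n d'
  haveI : IsClosedImmersion (e.ι ≫ ProjectiveSpace.segrePow e.n ℂ d').left := by
    change IsClosedImmersion (e.ι.left ≫ (ProjectiveSpace.segrePow e.n ℂ d').left)
    infer_instance
  haveI := isClosedImmersion_tensorHom_left (X := A.X) (Y := A.X) (e.ι ≫ ProjectiveSpace.segrePow e.n ℂ d') e.ι
  obtain ⟨ιB, hιB⟩ : ∃ ιB : B.X ⟶ projectiveSpace
      (ProjectiveSpace.segrePowDim e.n d' * e.n + ProjectiveSpace.segrePowDim e.n d' + e.n) ℂ,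
      ιB = ιι ≫ ((e.ι ≫ ProjectiveSpace.segrePow e.n ℂ d') ⊗ₘ e.ι) ≫
        segreEmbedding (ProjectiveSpace.segrePowDim e.n d') e.n ℂ := ⟨_, rfl⟩
  have hιBci : IsClosedImmersion ιB.left := by
    rw [hιB]
    change IsClosedImmersion (ιι.left ≫ ((e.ι ≫ ProjectiveSpace.segrePow e.n ℂ d') ⊗ₘ e.ι).left ≫
      (segreEmbedding (ProjectiveSpace.segrePowDim e.n d') e.n ℂ).left)
    infer_instance
  have e1 : ∀ z, complexBetti.map ιι 2 (complexBetti.map (CartesianMonoidalCategory.fst A.X A.X) 2 z) =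
      complexBetti.map f.hom.hom.hom 2 z := fun z => by
    rw [← map_comp_apply', hf₁]
  have e2 : ∀ z, complexBetti.map ιι 2 (complexBetti.map (CartesianMonoidalCategory.snd A.X A.X) 2 z) =
      complexBetti.map ψ.hom.hom.hom 2 (complexBetti.map f.hom.hom.hom 2 z) := fun z => by
    rw [← map_comp_apply', hf₂, map_map_hom_apply]
  -- the hyperplane class of `e'` on the Segre-additive generator: `d·Y + ψ^*Y`, `Y = f^*e^*gen`
  have hcl : complexBetti.map ιB 2 (g _) =
      ((d' + 1 : ℕ) : ℂ) • complexBetti.map f.hom.hom.hom 2 (complexBetti.map e.ι 2 (g e.n)) +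
        complexBetti.map ψ.hom.hom.hom 2 (complexBetti.map f.hom.hom.hom 2 (complexBetti.map e.ι 2 (g e.n))) := by
    rw [hιB, map_comp_apply', map_comp_apply', hgσ (ProjectiveSpace.segrePowDim e.n d') e.n, map_add,
      map_tensorHom_map_fst, map_tensorHom_map_snd, map_comp_apply' e.ι, map_segrePow_of_additive g hgσ e.n d']
    simp only [map_smul, map_add, e1, e2]
  -- `y = f^*e^*a = q·Y`
  have hy : complexBetti.map e.ι 2 a = (q : ℂ) • complexBetti.map e.ι 2 (g e.n) := by rw [hq, map_smul]
  have hqC : (q : ℂ) ≠ 0 := by exact_mod_cast hq0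
  refine ⟨B, p, f, ψ, hp, hf, hpf, hfp, hψ, hfφ, hpψ, ⟨_, ιB, hιBci⟩, g _, 2 * ((d' + 1 : ℕ) : ℚ) * q⁻¹,
    hgr _, hgnz _ (le_trans hN1 (Nat.le_add_left _ _)), ?_, ?_⟩
  · exact mul_ne_zero (mul_ne_zero two_ne_zero (by exact_mod_cast Nat.succ_ne_zero d')) (inv_ne_zero hq0)
  · change ((d' + 1 : ℕ) : ℂ) • complexBetti.map ιB 2 (g _) + complexBetti.map ψ.hom.hom.hom 2
      (complexBetti.map ιB 2 (g _)) = _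
    rw [hcl, symmetrised_symmetrised hψ, hy]
    simp only [map_smul]
    rw [smul_comm (((d' + 1 : ℕ) : ℂ)) ((q : ℚ) : ℂ), ← smul_add, smul_smul]
    congr 1
    push_cast
    rw [inv_mul_cancel_right₀ hqC]

end Summit.HodgeConjecture.HodgeConjecture.Ring2.AbelianAll

end
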